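import Literature.MathematicalPhysics.QuantumLattice.BCSPairEtaSpinAlgebra
import HarnessLib

/-!
# Reflection positivity with the nearest-neighbour Coulomb repulsion `g' Σ Γ³_xΓ³_y` (Koma 2022, §8,
# (8.1)–(8.4)), in Lieb's reflection frame

T. Koma, *Nambu–Goldstone modes for superconducting lattice fermions*, arXiv:2201.13135 (2022)
[Koma2022], (2.6) and §8: the second term of the interaction (2.6),
`H_repul = g' Σ_{|x-y|=1} (n_{x↑} + n_{x↓} - 1)(n_{y↑} + n_{y↓} - 1) = g' Σ_{|x-y|=1} Γ³_xΓ³_y` ((8.1),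
`Γ³_x = 1 - n_{x↑} - n_{x↓}`), "is a nearest-neighbour repulsive Coulomb interaction"; "The same method as
in Sec. 5 is applicable again, and one has `Tr exp[-βH(B,0,g',h')] ≤ Tr exp[-βH(B,0,g',0)]`" ((8.4)).

This file adds the Coulomb term to the reflection-positivity layer of
`BCSPairHoppingReflectionPositivity.lean` (Koma Prop. 5.1 / Cor. 5.2 in Lieb's frame), with the
Dyson–Lieb–Simon field kept on the PAIR interaction (the field `h'` of (8.2) on the Coulomb term is not
transcribed — it is only needed for the susceptibility bound (8.12) of Theorem 2.2):

* `PairHopRP.coulomb G g' = Σ_{x∼y ordered} (g'/2) Γ³_xΓ³_y = g' Σ_{bonds} Γ³_xΓ³_y` ((8.1)) and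
  `PairHopRP.hamiltonianC G T U g g' h B = hamiltonian G T U g h B + coulomb G g'` — Koma's `H(B,h)` of
  (3.6) with the Coulomb term of (2.6) (in Lieb's frame; the `η`-rotation of the odd sublattice fixes `Γ³`);
* `splitHom_coulomb` — `Φ(H_repul) = H_repul,L ⊗ 1 + 1 ⊗ H_repul,R + g' Σ_{cut} Γ³_l ⊗ Γ³_r`;
* `PairHopCutRP.antiConj_thetaT_gammaThree` — **`Θ(Γ³_l) = -Γ³_r`** (Lieb's reflection is a particle–hole
  antiunitary, `Θ(n_l) = 1 - n_r`), so the crossing Coulomb term `-βg' Γ³_l ⊗ Γ³_r = M ⊗ Θ(M)` with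
  `M = √(βg') Γ³_l` has the Dyson–Lieb–Simon sign for `g' ≥ 0` — the repulsive sign, as Koma notes;
* **`PairHopCutRP.partitionFn_sq_le_reflected_coulomb`** — for `β, g, g' ≥ 0`, Hermitian hopping with
  real nonnegative cut amplitudes, any `U`, `B`, and any pair field `h`:
  `Z_β(T; g, g', h; B)² ≤ Z_β(amplLL T; g, g', h_LL; B) · Z_β(amplRR T; g, g', h_RR; B)` — (5.99) with
  the Coulomb term ((8.4) at `h' = 0`), and the `β → ∞` form `groundEnergy_add_le_two_mul_coulomb`.

No named fact.

## References

* [Koma2022] T. Koma, arXiv:2201.13135, (2.6), (3.9), §8 (8.1)–(8.4), Prop. 5.1, Cor. 5.2.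
* [Lieb1994] E. H. Lieb, Phys. Rev. Lett. 73 (1994) 2158, p. 2 (`W⁰` is reflection invariant), eq. (4).
* [DLS1978] F. J. Dyson, E. H. Lieb, B. Simon, J. Stat. Phys. 18 (1978) 335, Lemma 4.1, Thm. 4.2.
-/

noncomputable section

namespace Literature.MathematicalPhysics.QuantumLattice

open Matrix Finset HubbardWave0 JWSplit PeierlsSplit NormedSpace
open scoped Kronecker ComplexOrder

namespace PairHopRP

/-! ### The Coulomb term -/

section Coulomb

variable {Λ : Type*} [LinearOrder Λ] [Fintype Λ]

/-- `n_{xσ}` is a real matrix. [cite: Koma2022, §5 ("the fermion operators have a real representation")] -/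
theorem numberOp_conjTranspose_transpose (x : Λ) (σ : Fin 2) : (numberOp x σ)ᴴᵀ = numberOp x σ :=
  conjTranspose_transpose_of_transpose_eq_conjTranspose
    (mul_transpose_eq_conjTranspose (creation_transpose_eq_conjTranspose _)
      (annihilation_transpose_eq_conjTranspose _))

/-- `Γ³_x` is a real matrix. [cite: Koma2022, (3.9), §5] -/
theorem gammaThree_conjTranspose_transpose (x : Λ) : (gammaThree x)ᴴᵀ = gammaThree x := by
  rw [gammaThree, conjTranspose_sub, conjTranspose_sub, conjTranspose_one, transpose_sub, transpose_sub,
    transpose_one, numberOp_conjTranspose_transpose, numberOp_conjTranspose_transpose]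

variable (G : SimpleGraph Λ) [DecidableRel G.Adj]

/-- The Coulomb bond operator on an ORDERED bond: `(g'/2) Γ³_xΓ³_y`. [cite: Koma2022, (8.1)] -/
def coulombBond (g' : ℝ) (x y : Λ) : Matrix (Finset (Orb Λ)) (Finset (Orb Λ)) ℂ :=
  ((g' / 2 : ℝ) : ℂ) • (gammaThree x * gammaThree y)

/-- **The nearest-neighbour Coulomb repulsion** `H_repul = Σ_{x∼y ordered} (g'/2)Γ³_xΓ³_y = g'Σ_{bonds}Γ³_xΓ³_y
= g' Σ_{bonds} (n_x - 1)(n_y - 1)`. [cite: Koma2022, (2.6), (8.1)] -/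
def coulomb (g' : ℝ) : Matrix (Finset (Orb Λ)) (Finset (Orb Λ)) ℂ :=
  ∑ x : Λ, ∑ y : Λ, if G.Adj x y then coulombBond g' x y else 0

/-- **The Hamiltonian with the Coulomb term**: `H(T, U; g, g', h; B) = H(T, U; g, h; B) + H_repul(g')`.
[cite: Koma2022, (2.4), (2.6), (3.6), (8.3)] -/
def hamiltonianC (T : Fin 2 → Λ → Λ → ℂ) (U g g' : ℝ) (h : Λ → Λ → ℝ) (B : ℝ) :
    Matrix (Finset (Orb Λ)) (Finset (Orb Λ)) ℂ :=
  hamiltonian G T U g h B + coulomb G g'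

/-- `(Γ³_xΓ³_y)ᴴ = Γ³_yΓ³_x`. [cite: Koma2022, (3.9)] -/
theorem conjTranspose_gammaThree_mul (x y : Λ) :
    (gammaThree x * gammaThree y)ᴴ = gammaThree y * gammaThree x := by
  rw [conjTranspose_mul, (gammaThree_isHermitian y).eq, (gammaThree_isHermitian x).eq]

/-- `H_repul` is Hermitian. [cite: Koma2022, (8.1)] -/
theorem coulomb_isHermitian (g' : ℝ) : (coulomb G g').IsHermitian := by
  rw [IsHermitian, coulomb, conjTranspose_sum]
  simp only [conjTranspose_sum]
  rw [Finset.sum_comm]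
  refine Finset.sum_congr rfl fun x _ => Finset.sum_congr rfl fun y _ => ?_
  by_cases hxy : G.Adj x y
  · rw [if_pos hxy, if_pos ((G.adj_comm _ _).1 hxy), coulombBond, coulombBond, conjTranspose_smul,
      conjTranspose_gammaThree_mul, Complex.star_def, Complex.conj_ofReal]
  · rw [if_neg hxy, if_neg (fun h => hxy ((G.adj_comm _ _).1 h)), conjTranspose_zero]

/-- `H(T, U; g, g', h; B)` is Hermitian for Hermitian hopping. [cite: Koma2022, (2.4), (8.3)] -/
theorem hamiltonianC_isHermitian (T : Fin 2 → Λ → Λ → ℂ) (hT : ∀ σ x y, T σ y x = star (T σ x y))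
    (U g g' : ℝ) (h : Λ → Λ → ℝ) (B : ℝ) : (hamiltonianC G T U g g' h B).IsHermitian :=
  (hamiltonian_isHermitian G T hT U g h B).add (coulomb_isHermitian G g')

end Coulomb

/-! ### Kronecker form of the Coulomb term under the splitting isomorphism -/

section Split

variable {Λ : Type*} [LinearOrder Λ] [Fintype Λ] (p : Λ → Prop) [DecidablePred p]

/-- `Φ(Γ³_x) = Γ³_x ⊗ 1` for a left site. [cite: Koma2022, (5.56)] -/
theorem splitHom_gammaThree_of_pos (x : Λ) (hx : p x) :
    splitHom p (gammaThree x) =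
      gammaThree (⟨x, hx⟩ : Lsub p) ⊗ₖ (1 : Matrix (Finset (Orb (Rsub p))) _ ℂ) := by
  rw [gammaThree, gammaThree, map_sub, map_sub, map_one, splitHom_numberOp_of_pos p x 0 hx,
    splitHom_numberOp_of_pos p x 1 hx, ← one_kronecker_one, ← sub_kronecker, ← sub_kronecker]

/-- `Φ(Γ³_y) = 1 ⊗ Γ³_y` for a right site. [cite: Koma2022, (5.56)] -/
theorem splitHom_gammaThree_of_neg (y : Λ) (hy : ¬p y) :
    splitHom p (gammaThree y) =
      (1 : Matrix (Finset (Orb (Lsub p))) _ ℂ) ⊗ₖ gammaThree (⟨y, hy⟩ : Rsub p) := by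
  rw [gammaThree, gammaThree, map_sub, map_sub, map_one, splitHom_numberOp_of_neg p y 0 hy,
    splitHom_numberOp_of_neg p y 1 hy, ← one_kronecker_one, ← kronecker_sub, ← kronecker_sub]

variable (G : SimpleGraph Λ) [DecidableRel G.Adj]

/-- **The crossing part of the Coulomb term**: `g' Σ_{l∼r, l left, r right} Γ³_l ⊗ Γ³_r`.
[cite: Koma2022, (8.1), (5.57)] -/
def crossCoulomb (g' : ℝ) :
    Matrix (Finset (Orb (Lsub p)) × Finset (Orb (Rsub p)))
      (Finset (Orb (Lsub p)) × Finset (Orb (Rsub p))) ℂ :=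
  ∑ a : Lsub p, ∑ b : Rsub p, if G.Adj a.1 b.1 then (g' : ℂ) • (gammaThree a ⊗ₖ gammaThree b) else 0

/-- **`Φ(H_repul) = H_repul,L ⊗ 1 + 1 ⊗ H_repul,R + crossCoulomb`.** [cite: Koma2022, (8.1), (5.55)–(5.57)] -/
theorem splitHom_coulomb (g' : ℝ) :
    splitHom p (coulomb G g') =
      coulomb (leftGraph p G) g' ⊗ₖ (1 : Matrix (Finset (Orb (Rsub p))) _ ℂ) +
        (1 : Matrix (Finset (Orb (Lsub p))) _ ℂ) ⊗ₖ coulomb (rightGraph p G) g' + crossCoulomb p G g' := by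
  set F : Λ → Λ → Matrix (Finset (Orb Λ)) (Finset (Orb Λ)) ℂ := fun x y =>
    if G.Adj x y then coulombBond g' x y else 0 with hF
  have hsplit : ∀ x y, splitHom p (F x y) = if G.Adj x y then splitHom p (coulombBond g' x y) else 0 := by
    intro x y
    rw [hF]
    dsimp only
    split_ifs
    · rfl
    · exact map_zero _
  -- LL block
  have hLL : ∑ a : Lsub p, ∑ a' : Lsub p, splitHom p (F a.1 a'.1) =
      coulomb (leftGraph p G) g' ⊗ₖ (1 : Matrix (Finset (Orb (Rsub p))) _ ℂ) := by
    rw [coulomb, sum_kronecker]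
    refine Finset.sum_congr rfl fun a _ => ?_
    rw [sum_kronecker]
    refine Finset.sum_congr rfl fun a' _ => ?_
    rw [hsplit, ite_kronecker]
    by_cases hadj : G.Adj a.1 a'.1
    · rw [if_pos hadj, if_pos (show (leftGraph p G).Adj a a' from hadj), coulombBond, coulombBond, map_smul,
        map_mul, splitHom_gammaThree_of_pos p a.1 a.2, splitHom_gammaThree_of_pos p a'.1 a'.2,
        ← mul_kronecker_mul, Matrix.mul_one, smul_kronecker]
    · rw [if_neg hadj, if_neg (show ¬(leftGraph p G).Adj a a' from hadj)]
  -- RR block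
  have hRR : ∑ b : Rsub p, ∑ b' : Rsub p, splitHom p (F b.1 b'.1) =
      (1 : Matrix (Finset (Orb (Lsub p))) _ ℂ) ⊗ₖ coulomb (rightGraph p G) g' := by
    rw [coulomb, kronecker_sum]
    refine Finset.sum_congr rfl fun b _ => ?_
    rw [kronecker_sum]
    refine Finset.sum_congr rfl fun b' _ => ?_
    rw [hsplit, kronecker_ite]
    by_cases hadj : G.Adj b.1 b'.1
    · rw [if_pos hadj, if_pos (show (rightGraph p G).Adj b b' from hadj), coulombBond, coulombBond, map_smul,
        map_mul, splitHom_gammaThree_of_neg p b.1 b.2, splitHom_gammaThree_of_neg p b'.1 b'.2,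
        ← mul_kronecker_mul, Matrix.mul_one, kronecker_smul]
    · rw [if_neg hadj, if_neg (show ¬(rightGraph p G).Adj b b' from hadj)]
  -- LR + RL blocks
  have hLRRL : ∑ a : Lsub p, ∑ b : Rsub p, splitHom p (F a.1 b.1) +
      ∑ b : Rsub p, ∑ a : Lsub p, splitHom p (F b.1 a.1) = crossCoulomb p G g' := by
    rw [Finset.sum_comm (f := fun (b : Rsub p) (a : Lsub p) => splitHom p (F b.1 a.1)),
      ← Finset.sum_add_distrib, crossCoulomb]
    refine Finset.sum_congr rfl fun a _ => ?_
    rw [← Finset.sum_add_distrib]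
    refine Finset.sum_congr rfl fun b _ => ?_
    rw [hsplit, hsplit]
    by_cases hadj : G.Adj a.1 b.1
    · have hba : G.Adj b.1 a.1 := (G.adj_comm _ _).1 hadj
      rw [if_pos hadj, if_pos hba, if_pos hadj, coulombBond, coulombBond, map_smul, map_smul, map_mul, map_mul,
        splitHom_gammaThree_of_pos p a.1 a.2, splitHom_gammaThree_of_neg p b.1 b.2, ← mul_kronecker_mul,
        ← mul_kronecker_mul, Matrix.mul_one, Matrix.one_mul, Matrix.mul_one, Matrix.one_mul, ← add_smul,
        ← Complex.ofReal_add, add_halves]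
    · have hba : ¬G.Adj b.1 a.1 := fun h' => hadj ((G.adj_comm _ _).1 h')
      rw [if_neg hadj, if_neg hba, if_neg hadj, add_zero]
  -- assemble
  have hexp : coulomb G g' = ∑ x : Λ, ∑ y : Λ, F x y := rfl
  rw [hexp, map_sum, sum_eq_sum_add_sum p]
  simp only [map_sum]
  have e1 : ∀ x : Λ, ∑ y : Λ, splitHom p (F x y) =
      ∑ a' : Lsub p, splitHom p (F x a'.1) + ∑ b' : Rsub p, splitHom p (F x b'.1) :=
    fun x => sum_eq_sum_add_sum p _
  simp only [e1, Finset.sum_add_distrib]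
  rw [hLL, hRR, ← hLRRL]
  abel

/-- **`Φ(H(T,U;g,g',h;B))` in Kronecker form**:
`Φ(H) = (H_L + H_repul,L) ⊗ 1 + 1 ⊗ (H_R + H_repul,R) + crossTerm(T) - crossPair(g,h) + crossCoulomb(g')`.
[cite: Koma2022, (5.63)–(5.64), (8.1)] -/
theorem splitHom_hamiltonianC (T : Fin 2 → Λ → Λ → ℂ) (U g g' : ℝ) (h : Λ → Λ → ℝ) (B : ℝ) :
    splitHom p (hamiltonianC G T U g g' h B) =
      (leftTotal p G T U g h B + coulomb (leftGraph p G) g') ⊗ₖ (1 : Matrix (Finset (Orb (Rsub p))) _ ℂ) +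
        (1 : Matrix (Finset (Orb (Lsub p))) _ ℂ) ⊗ₖ (rightTotal p G T U g h B + coulomb (rightGraph p G) g') +
        crossTerm p G T - crossPair p G g h + crossCoulomb p G g' := by
  rw [hamiltonianC, map_add, splitHom_hamiltonian, splitHom_coulomb, add_kronecker, kronecker_add]
  abel

end Split

end PairHopRP

/-! ## The even torus cut by a plane -/

namespace PairHopCutRP

open FermionTorus.Cut PairHopRP LiebCutRP

attribute [local instance] LiebCutRP.decEqTorus

variable {d L : ℕ} [NeZero L]

/-! ### `Θ` on `Γ³` and on the Coulomb term -/

omit [NeZero L] in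
/-- **`Θ(n_{lσ}) = 1 - n_{Rl,σ}`**: Lieb's reflection is a particle–hole antiunitary. [cite: Lieb1994, p. 2] -/
theorem antiConj_thetaT_numberOp (hL : Even L) (a : LS d L) (σ : Fin 2) :
    antiConj (thetaT d hL) (numberOp a σ) = 1 - numberOp (leftEquivRight hL a) σ := by
  rw [antiConj_def, numberOp_conjTranspose_transpose,
    show numberOp a σ = numberAt (orb a σ) from rfl, thetaMatrix_conj_numberAt, orbReflect_orb]
  rfl

omit [NeZero L] in
/-- **`Θ(Γ³_l) = -Γ³_{Rl}`** (`Γ³ = 1 - n_↑ - n_↓`). [cite: Koma2022, (3.9), §8] [cite: Lieb1994, p. 2] -/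
theorem antiConj_thetaT_gammaThree (hL : Even L) (a : LS d L) :
    antiConj (thetaT d hL) (gammaThree a) = -gammaThree (leftEquivRight hL a) := by
  rw [gammaThree, antiConj_sub', antiConj_sub', antiConj_one (thetaMatrix_mul_conjTranspose _),
    antiConj_thetaT_numberOp, antiConj_thetaT_numberOp, gammaThree]
  abel

/-- **`Θ(H_repul,L) = H_repul,R`** (`Θ(Γ³_lΓ³_{l'}) = Γ³_{Rl}Γ³_{Rl'}`, and `R` maps left bonds to right bonds).
[cite: Koma2022, (8.1), (5.41)] [cite: Lieb1994, eq. (4)] -/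
theorem antiConj_thetaT_coulomb (hL : Even L) (h2 : 2 ≤ L) (g' : ℝ) :
    antiConj (thetaT d hL) (coulomb (leftGraph (IsLeft L) (G d L)) g') =
      coulomb (rightGraph (IsLeft L) (G d L)) g' := by
  have hV : (thetaT d hL)ᴴ * thetaT d hL = 1 := conjTranspose_thetaMatrix_mul_self _
  set e := leftEquivRight (d := d) (L := L) hL with he
  rw [coulomb, coulomb, antiConj_sum, ← e.sum_comp]
  refine Finset.sum_congr rfl fun a _ => ?_
  rw [antiConj_sum, ← e.sum_comp]
  refine Finset.sum_congr rfl fun a' _ => ?_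
  have hadj : (rightGraph (IsLeft L) (G d L)).Adj (e a) (e a') ↔ (leftGraph (IsLeft L) (G d L)).Adj a a' := by
    simp only [SimpleGraph.comap_adj, Function.Embedding.coe_subtype, he, leftEquivRight_apply]
    rw [adj_reflect_iff h2]
  by_cases h : (leftGraph (IsLeft L) (G d L)).Adj a a'
  · rw [if_pos h, if_pos (hadj.2 h), coulombBond, coulombBond, antiConj_ofReal_smul, antiConj_mul hV,
      antiConj_thetaT_gammaThree, antiConj_thetaT_gammaThree, neg_mul_neg]
  · rw [if_neg h, if_neg (fun h' => h (hadj.1 h')), antiConj_zero]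

/-- On the torus the Coulomb crossing sits at the boundary sites:
`crossCoulomb = Σ_{l ∈ ∂} g' Γ³_l ⊗ Γ³_{Rl}`. [cite: Koma2022, (8.1), (5.57)] -/
theorem crossCoulomb_eq (hL : Even L) (h4 : 4 ≤ L) (g' : ℝ) :
    crossCoulomb (IsLeft L) (G d L) g' =
      ∑ a : LS d L, if IsBoundary L a.1 then (g' : ℂ) • (gammaThree a ⊗ₖ gammaThree (leftEquivRight hL a)) else 0 := by
  rw [crossCoulomb]
  refine Finset.sum_congr rfl fun a _ => ?_
  rw [sum_right_adj_eq hL h4 a (fun b => (g' : ℂ) • (gammaThree a ⊗ₖ gammaThree b))]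

/-! ### The Coulomb letters -/

/-- Index of the Coulomb letters: the boundary sites. [cite: Koma2022, (8.1), (5.74)] -/
abbrev CCutIdx (d L : ℕ) : Type := {a : LS d L // IsBoundary L a.1}

/-- The left Coulomb letter `M = √(βg') Γ³_l`. [cite: Koma2022, §8 ("the same method as in Sec. 5")] [cite: DLS1978, Lemma 4.1] -/
def Mcoul (β g' : ℝ) (i : CCutIdx d L) : Matrix (Finset (Orb (LS d L))) (Finset (Orb (LS d L))) ℂ :=
  (Real.sqrt (β * g') : ℂ) • gammaThree i.1

/-- The right Coulomb letter `N = Θ(M) = -√(βg') Γ³_{Rl}`. [cite: Koma2022, §8] [cite: DLS1978, Lemma 4.1] -/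
def Ncoul (hL : Even L) (β g' : ℝ) (i : CCutIdx d L) : Matrix (Finset (Orb (RS d L))) (Finset (Orb (RS d L))) ℂ :=
  (-(Real.sqrt (β * g') : ℂ)) • gammaThree (leftEquivRight hL i.1)

omit [NeZero L] in
/-- `J_V(M_i) = N_i`. [cite: Koma2022, §8] [cite: DLS1978, Lemma 4.1] -/
theorem antiConj_thetaT_Mcoul (hL : Even L) (β g' : ℝ) (i : CCutIdx d L) :
    antiConj (thetaT d hL) (Mcoul β g' i) = Ncoul hL β g' i := by
  rw [Mcoul, Ncoul, antiConj_ofReal_smul, antiConj_thetaT_gammaThree, smul_neg, ← neg_smul]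

omit [NeZero L] in
/-- `J_{Vᵀ}(N_i) = M_i`. [cite: Koma2022, §8] [cite: DLS1978, Lemma 4.1] -/
theorem antiConj_transpose_Ncoul (hL : Even L) (β g' : ℝ) (i : CCutIdx d L) :
    antiConj (thetaT d hL)ᵀ (Ncoul hL β g' i) = Mcoul β g' i := by
  rw [← antiConj_thetaT_Mcoul hL, antiConj_transpose_antiConj (conjTranspose_thetaMatrix_mul_self _)]

omit [NeZero L] in
/-- A sum over the boundary subtype is an indicator sum over the left sites. [folklore] -/
private theorem sum_boundary_subtype' {M : Type*} [AddCommMonoid M] (f : LS d L → M) :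
    ∑ a' : CCutIdx d L, f a'.1 = ∑ a : LS d L, if IsBoundary L a.1 then f a else 0 := by
  rw [← Finset.sum_filter]
  exact (Finset.sum_subtype (univ.filter fun a : LS d L => IsBoundary L a.1) (fun a => by simp) f).symm

/-- **The Coulomb letters reproduce the crossing**: `Σᵢ Mᵢ ⊗ Nᵢ = -β · crossCoulomb` (`βg' ≥ 0`): the
REPULSIVE sign is the reflection-positive one, because `Θ(Γ³_l) = -Γ³_r`. [cite: Koma2022, §8 (8.1)–(8.4)]
[cite: DLS1978, Lemma 4.1] -/
theorem sum_Mcoul_kronecker_Ncoul (hL : Even L) (h4 : 4 ≤ L) {β g' : ℝ} (hβg' : 0 ≤ β * g') :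
    ∑ i : CCutIdx d L, Mcoul β g' i ⊗ₖ Ncoul hL β g' i = (-(β : ℂ)) • crossCoulomb (IsLeft L) (G d L) g' := by
  have hr : ((Real.sqrt (β * g') : ℂ)) * (-(Real.sqrt (β * g') : ℂ)) = -((β * g' : ℝ) : ℂ) := by
    rw [mul_neg, ← Complex.ofReal_mul, Real.mul_self_sqrt hβg']
  have hlhs : ∑ i : CCutIdx d L, Mcoul β g' i ⊗ₖ Ncoul hL β g' i =
      ∑ a : LS d L, if IsBoundary L a.1 then
        ((Real.sqrt (β * g') : ℂ) • gammaThree a) ⊗ₖ ((-(Real.sqrt (β * g') : ℂ)) • gammaThree (leftEquivRight hL a))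
        else 0 :=
    sum_boundary_subtype' (fun a : LS d L => ((Real.sqrt (β * g') : ℂ) • gammaThree a) ⊗ₖ
      ((-(Real.sqrt (β * g') : ℂ)) • gammaThree (leftEquivRight hL a)))
  rw [hlhs, crossCoulomb_eq hL h4, Finset.smul_sum]
  refine Finset.sum_congr rfl fun a _ => ?_
  split_ifs
  · rw [smul_kronecker_smul, hr, smul_smul]
    congr 1
    push_cast
    ring
  · rw [smul_zero]

/-! ### The three Dyson–Lieb–Simon identities with the Coulomb term -/

section DLS

variable (hL : Even L) (h4 : 4 ≤ L)
include hL h4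

omit [NeZero L] hL h4 in
/-- `J_V(-β X) = -β J_V(X)` for real `β`. [folklore] -/
private theorem antiConj_neg_ofReal_smul' {m' n' : Type*} [Fintype m'] (V : Matrix n' m' ℂ) (β : ℝ)
    (X : Matrix m' m' ℂ) : antiConj V ((-(β : ℂ)) • X) = (-(β : ℂ)) • antiConj V X := by
  rw [antiConj_smul, star_neg, Complex.star_def, Complex.conj_ofReal]

/-- **`Φ(-βH_repul)` in DLS form**: `(-βH_repul,L) ⊗ 1 + 1 ⊗ (-βH_repul,R) + Σᵢ Mᵢ ⊗ Nᵢ`.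
[cite: Koma2022, (8.1), (5.63)–(5.64)] [cite: DLS1978, Lemma 4.1] -/
theorem splitHom_neg_smul_coulomb {β g' : ℝ} (hβg' : 0 ≤ β * g') :
    splitHom (IsLeft L) ((-(β : ℂ)) • coulomb (G d L) g') =
      ((-(β : ℂ)) • coulomb (leftGraph (IsLeft L) (G d L)) g') ⊗ₖ (1 : Matrix (Finset (Orb (RS d L))) _ ℂ) +
        (1 : Matrix (Finset (Orb (LS d L))) _ ℂ) ⊗ₖ ((-(β : ℂ)) • coulomb (rightGraph (IsLeft L) (G d L)) g') +
        ∑ i : CCutIdx d L, Mcoul β g' i ⊗ₖ Ncoul hL β g' i := by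
  have hs : splitHom (IsLeft L) ((-(β : ℂ)) • coulomb (G d L) g') =
      (-(β : ℂ)) • splitHom (IsLeft L) (coulomb (G d L) g') :=
    (splitHom (IsLeft L)).toLinearEquiv.map_smul _ _
  rw [hs, splitHom_coulomb, sum_Mcoul_kronecker_Ncoul hL h4 hβg', smul_add, smul_add, smul_kronecker,
    kronecker_smul]

/-- **The original system with the Coulomb term in DLS form**:
`(A + A') ⊗ 1 + 1 ⊗ (B + B') + Σᵢ Mᵢ ⊗ Nᵢ = Φ(-βH(T; g, g', h; B))`, `A' = -βH_repul,L`, `B' = -βH_repul,R`,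
the families of the hopping, pair and Coulomb letters. [cite: Koma2022, (5.63)–(5.64), (5.74), §8]
[cite: DLS1978, Lemma 4.1] -/
theorem dls_original_coulomb {β : ℝ} {tc : Fin 2 → FermionTorus (d + 1) L → ℝ}
    (hβt : ∀ σ x, IsBoundary L x → 0 ≤ β * tc σ x) {g : ℝ} (hβg : 0 ≤ β * (g / 4)) {g' : ℝ}
    (hβg' : 0 ≤ β * g') (U : ℝ) (T : Fin 2 → FermionTorus (d + 1) L → FermionTorus (d + 1) L → ℂ)
    (hcut : ∀ σ x, IsBoundary L x → T σ x (reflect x) = tc σ x ∧ T σ (reflect x) x = tc σ x)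
    (h : FermionTorus (d + 1) L → FermionTorus (d + 1) L → ℝ) (B : ℝ) :
    ((-(β : ℂ)) • (leftTotal (IsLeft L) (G d L) T U g h B + coulomb (leftGraph (IsLeft L) (G d L)) g')) ⊗ₖ
          (1 : Matrix (Finset (Orb (RS d L))) _ ℂ) +
        (1 : Matrix (Finset (Orb (LS d L))) _ ℂ) ⊗ₖ
          ((-(β : ℂ)) • (rightTotal (IsLeft L) (G d L) T U g h B + coulomb (rightGraph (IsLeft L) (G d L)) g')) +
        ∑ i : (CutIdx d L ⊕ PCutIdx d L) ⊕ CCutIdx d L,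
          Sum.elim (Sum.elim (Mfam β tc) (Mpair β g h)) (Mcoul β g') i ⊗ₖ
            Sum.elim (Sum.elim (Nfam hL β tc) (Npair hL β g h)) (Ncoul hL β g') i =
      splitHom (IsLeft L) ((-(β : ℂ)) • PairHopRP.hamiltonianC (G d L) T U g g' h B) := by
  conv_rhs => rw [PairHopRP.hamiltonianC, smul_add, map_add, ← dls_original hL h4 hβt hβg U T hcut h B,
    splitHom_neg_smul_coulomb hL h4 hβg']
  simp only [Fintype.sum_sum_type, Sum.elim_inl, Sum.elim_inr, smul_add, add_kronecker, kronecker_add]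
  abel

/-- **The first comparison system with the Coulomb term**:
`(A + A') ⊗ 1 + 1 ⊗ Θ(A + A') + Σᵢ Mᵢ ⊗ Θ(Mᵢ) = Φ(-βH(amplLL T; g, g', h_LL; B))` (`Θ(H_repul,L) = H_repul,R`).
[cite: Koma2022, Prop. 5.1 (5.65), Cor. 5.2, §8 (8.4)] [cite: DLS1978, Lemma 4.1] -/
theorem dls_left_coulomb {β : ℝ} {tc : Fin 2 → FermionTorus (d + 1) L → ℝ}
    (hβt : ∀ σ x, IsBoundary L x → 0 ≤ β * tc σ x) {g : ℝ} (hβg : 0 ≤ β * (g / 4)) {g' : ℝ}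
    (hβg' : 0 ≤ β * g') (U : ℝ) (T : Fin 2 → FermionTorus (d + 1) L → FermionTorus (d + 1) L → ℂ)
    (hT : ∀ σ x y, T σ y x = star (T σ x y)) (hcut : ∀ σ x, IsBoundary L x → T σ x (reflect x) = tc σ x)
    (h : FermionTorus (d + 1) L → FermionTorus (d + 1) L → ℝ) (B : ℝ) :
    ((-(β : ℂ)) • (leftTotal (IsLeft L) (G d L) T U g h B + coulomb (leftGraph (IsLeft L) (G d L)) g')) ⊗ₖ
          (1 : Matrix (Finset (Orb (RS d L))) _ ℂ) +
        (1 : Matrix (Finset (Orb (LS d L))) _ ℂ) ⊗ₖ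
          antiConj (thetaT d hL)
            ((-(β : ℂ)) • (leftTotal (IsLeft L) (G d L) T U g h B + coulomb (leftGraph (IsLeft L) (G d L)) g')) +
        ∑ i : (CutIdx d L ⊕ PCutIdx d L) ⊕ CCutIdx d L,
          Sum.elim (Sum.elim (Mfam β tc) (Mpair β g h)) (Mcoul β g') i ⊗ₖ
            antiConj (thetaT d hL) (Sum.elim (Sum.elim (Mfam β tc) (Mpair β g h)) (Mcoul β g') i) =
      splitHom (IsLeft L) ((-(β : ℂ)) • PairHopRP.hamiltonianC (G d L) (amplLL T) U g g' (fieldLL h) B) := by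
  conv_rhs => rw [PairHopRP.hamiltonianC, smul_add, map_add, ← dls_left hL h4 hβt hβg U T hT hcut h B,
    splitHom_neg_smul_coulomb hL h4 hβg']
  simp only [Fintype.sum_sum_type, Sum.elim_inl, Sum.elim_inr, antiConj_thetaT_Mcoul, smul_add, antiConj_add,
    add_kronecker, kronecker_add]
  rw [antiConj_neg_ofReal_smul' (thetaT d hL) β (coulomb (leftGraph (IsLeft L) (G d L)) g'),
    antiConj_thetaT_coulomb hL (by omega)]
  abel

/-- **The second comparison system with the Coulomb term**:
`Θ'(B + B') ⊗ 1 + 1 ⊗ (B + B') + Σᵢ Θ'(Nᵢ) ⊗ Nᵢ = Φ(-βH(amplRR T; g, g', h_RR; B))`.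
[cite: Koma2022, Prop. 5.1 (5.65), Cor. 5.2, §8 (8.4)] [cite: DLS1978, Lemma 4.1] -/
theorem dls_right_coulomb {β : ℝ} {tc : Fin 2 → FermionTorus (d + 1) L → ℝ}
    (hβt : ∀ σ x, IsBoundary L x → 0 ≤ β * tc σ x) {g : ℝ} (hβg : 0 ≤ β * (g / 4)) {g' : ℝ}
    (hβg' : 0 ≤ β * g') (U : ℝ) (T : Fin 2 → FermionTorus (d + 1) L → FermionTorus (d + 1) L → ℂ)
    (hT : ∀ σ x y, T σ y x = star (T σ x y)) (hcut : ∀ σ x, IsBoundary L x → T σ x (reflect x) = tc σ x)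
    (h : FermionTorus (d + 1) L → FermionTorus (d + 1) L → ℝ) (B : ℝ) :
    antiConj (thetaT d hL)ᵀ
          ((-(β : ℂ)) • (rightTotal (IsLeft L) (G d L) T U g h B + coulomb (rightGraph (IsLeft L) (G d L)) g')) ⊗ₖ
          (1 : Matrix (Finset (Orb (RS d L))) _ ℂ) +
        (1 : Matrix (Finset (Orb (LS d L))) _ ℂ) ⊗ₖ
          ((-(β : ℂ)) • (rightTotal (IsLeft L) (G d L) T U g h B + coulomb (rightGraph (IsLeft L) (G d L)) g')) +
        ∑ i : (CutIdx d L ⊕ PCutIdx d L) ⊕ CCutIdx d L,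
          antiConj (thetaT d hL)ᵀ (Sum.elim (Sum.elim (Nfam hL β tc) (Npair hL β g h)) (Ncoul hL β g') i) ⊗ₖ
            Sum.elim (Sum.elim (Nfam hL β tc) (Npair hL β g h)) (Ncoul hL β g') i =
      splitHom (IsLeft L) ((-(β : ℂ)) • PairHopRP.hamiltonianC (G d L) (amplRR T) U g g' (fieldRR h) B) := by
  have hV : (thetaT d hL)ᴴ * thetaT d hL = 1 := conjTranspose_thetaMatrix_mul_self _
  have hC : antiConj (thetaT d hL)ᵀ (coulomb (rightGraph (IsLeft L) (G d L)) g') =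
      coulomb (leftGraph (IsLeft L) (G d L)) g' := by
    rw [← antiConj_thetaT_coulomb hL (by omega) g', antiConj_transpose_antiConj hV]
  conv_rhs => rw [PairHopRP.hamiltonianC, smul_add, map_add, ← dls_right hL h4 hβt hβg U T hT hcut h B,
    splitHom_neg_smul_coulomb hL h4 hβg']
  simp only [Fintype.sum_sum_type, Sum.elim_inl, Sum.elim_inr, antiConj_transpose_Ncoul, smul_add, antiConj_add,
    add_kronecker, kronecker_add]
  rw [antiConj_neg_ofReal_smul' (thetaT d hL)ᵀ β (coulomb (rightGraph (IsLeft L) (G d L)) g'), hC]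
  abel

end DLS

/-! ### The reflection-positivity inequality with the Coulomb term -/

section Main

variable (hL : Even L) (h4 : 4 ≤ L)
include hL h4

omit [NeZero L] hL h4 in
/-- `Z_β(H) > 0` for the Hamiltonian with the Coulomb term. [cite: Koma2022, (2.10)] -/
theorem partitionFn_hamiltonianC_re_pos (T : Fin 2 → FermionTorus (d + 1) L → FermionTorus (d + 1) L → ℂ)
    (hT : ∀ σ x y, T σ y x = star (T σ x y)) (U g g' : ℝ)
    (h : FermionTorus (d + 1) L → FermionTorus (d + 1) L → ℝ) (B β : ℝ) :
    0 < ((PairHopRP.hamiltonianC (G d L) T U g g' h B).partitionFn β).re := by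
  haveI : Nonempty (Finset (Orb (FermionTorus (d + 1) L))) := ⟨∅⟩
  rw [(hamiltonianC_isHermitian (G d L) T hT U g g' h B).partitionFn_eq_ofReal, Complex.ofReal_re]
  exact (hamiltonianC_isHermitian (G d L) T hT U g g' h B).sum_exp_pos β

omit [NeZero L] hL h4 in
/-- `‖Z_β(H)‖ = Re Z_β(H)` for the Hamiltonian with the Coulomb term. [cite: Koma2022, (2.10)] -/
theorem norm_partitionFn_hamiltonianC (T : Fin 2 → FermionTorus (d + 1) L → FermionTorus (d + 1) L → ℂ)
    (hT : ∀ σ x y, T σ y x = star (T σ x y)) (U g g' : ℝ)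
    (h : FermionTorus (d + 1) L → FermionTorus (d + 1) L → ℝ) (B β : ℝ) :
    ‖(PairHopRP.hamiltonianC (G d L) T U g g' h B).partitionFn β‖ =
      ((PairHopRP.hamiltonianC (G d L) T U g g' h B).partitionFn β).re := by
  rw [(hamiltonianC_isHermitian (G d L) T hT U g g' h B).partitionFn_eq_ofReal, Complex.ofReal_re,
    Complex.norm_real, Real.norm_of_nonneg]
  rw [← Complex.ofReal_re (∑ i, Real.exp (-(β * (hamiltonianC_isHermitian (G d L) T hT U g g' h B).eigenvalues i))),
    ← (hamiltonianC_isHermitian (G d L) T hT U g g' h B).partitionFn_eq_ofReal]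
  exact (partitionFn_hamiltonianC_re_pos T hT U g g' h B β).le

/-- **Reflection positivity with the Coulomb repulsion (Koma (5.99) + (8.4), Lieb's frame).** On the even
torus `(ℤ/Lℤ)^{d+1}` (`L ≥ 4`) cut perpendicular to coordinate `0`, for `β ≥ 0`, `g ≥ 0`, `g' ≥ 0`, any real
`U` and source `B`, Hermitian hopping amplitudes real and nonnegative on the cut bonds, and any pair field `h`:
`Z_β(T; g, g', h; B)² ≤ Z_β(amplLL T; g, g', h_LL; B) · Z_β(amplRR T; g, g', h_RR; B)`.
[cite: Koma2022, Prop. 5.1 (5.65), Cor. 5.2 (5.99), §8 (8.4)] [cite: Lieb1994, Lemma, eq. (6)] [cite: DLS1978, Lemma 4.1] -/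
theorem partitionFn_sq_le_reflected_coulomb {β : ℝ} (hβ : 0 ≤ β) {g : ℝ} (hg : 0 ≤ g) {g' : ℝ} (hg' : 0 ≤ g')
    {tc : Fin 2 → FermionTorus (d + 1) L → ℝ} (htc : ∀ σ x, IsBoundary L x → 0 ≤ tc σ x) (U : ℝ)
    (T : Fin 2 → FermionTorus (d + 1) L → FermionTorus (d + 1) L → ℂ)
    (hT : ∀ σ x y, T σ y x = star (T σ x y)) (hcut : ∀ σ x, IsBoundary L x → T σ x (reflect x) = tc σ x)
    (h : FermionTorus (d + 1) L → FermionTorus (d + 1) L → ℝ) (B : ℝ) :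
    ((PairHopRP.hamiltonianC (G d L) T U g g' h B).partitionFn β).re ^ 2 ≤
      ((PairHopRP.hamiltonianC (G d L) (amplLL T) U g g' (fieldLL h) B).partitionFn β).re *
        ((PairHopRP.hamiltonianC (G d L) (amplRR T) U g g' (fieldRR h) B).partitionFn β).re := by
  have hβt : ∀ σ x, IsBoundary L x → 0 ≤ β * tc σ x := fun σ x hx => mul_nonneg hβ (htc σ x hx)
  have hβg : 0 ≤ β * (g / 4) := mul_nonneg hβ (by linarith)
  have hβg' : 0 ≤ β * g' := mul_nonneg hβ hg'
  have hV : (thetaT d hL)ᴴ * thetaT d hL = 1 := conjTranspose_thetaMatrix_mul_self _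
  have hV' : thetaT d hL * (thetaT d hL)ᴴ = 1 := thetaMatrix_mul_conjTranspose _
  have hW : ((thetaT d hL)ᵀ)ᴴ * (thetaT d hL)ᵀ = 1 := conjTranspose_transpose_mul_transpose hV'
  have hW' : (thetaT d hL)ᵀ * ((thetaT d hL)ᵀ)ᴴ = 1 := transpose_mul_conjTranspose_transpose hV
  have hDLS := Matrix.norm_trace_exp_kroneckerSum_le_antiConj
    ((-(β : ℂ)) • (leftTotal (IsLeft L) (G d L) T U g h B + coulomb (leftGraph (IsLeft L) (G d L)) g'))
    ((-(β : ℂ)) • (rightTotal (IsLeft L) (G d L) T U g h B + coulomb (rightGraph (IsLeft L) (G d L)) g'))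
    (Sum.elim (Sum.elim (Mfam β tc) (Mpair β g h)) (Mcoul β g'))
    (Sum.elim (Sum.elim (Nfam hL β tc) (Npair hL β g h)) (Ncoul hL β g')) hV hV' hW hW'
  rw [dls_original_coulomb hL h4 hβt hβg hβg' U T (cut_both hT hcut) h B,
    dls_left_coulomb hL h4 hβt hβg hβg' U T hT hcut h B, dls_right_coulomb hL h4 hβt hβg hβg' U T hT hcut h B,
    ← LiebRP.partitionFn_eq_trace_exp_splitHom, ← LiebRP.partitionFn_eq_trace_exp_splitHom,
    ← LiebRP.partitionFn_eq_trace_exp_splitHom, norm_partitionFn_hamiltonianC T hT U g g' h B β] at hDLS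
  have hposLL := (partitionFn_hamiltonianC_re_pos (amplLL T) (amplLL_herm hT) U g g' (fieldLL h) B β).le
  have hposRR := (partitionFn_hamiltonianC_re_pos (amplRR T) (amplRR_herm hT) U g g' (fieldRR h) B β).le
  have hpos := (partitionFn_hamiltonianC_re_pos T hT U g g' h B β).le
  calc ((PairHopRP.hamiltonianC (G d L) T U g g' h B).partitionFn β).re ^ 2
      ≤ (Real.sqrt ((PairHopRP.hamiltonianC (G d L) (amplLL T) U g g' (fieldLL h) B).partitionFn β).re *
          Real.sqrt ((PairHopRP.hamiltonianC (G d L) (amplRR T) U g g' (fieldRR h) B).partitionFn β).re) ^ 2 :=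
        pow_le_pow_left₀ hpos hDLS 2
    _ = ((PairHopRP.hamiltonianC (G d L) (amplLL T) U g g' (fieldLL h) B).partitionFn β).re *
          ((PairHopRP.hamiltonianC (G d L) (amplRR T) U g g' (fieldRR h) B).partitionFn β).re := by
        rw [mul_pow, Real.sq_sqrt hposLL, Real.sq_sqrt hposRR]

/-- **The `β → ∞` form**: `E₀(amplLL T; g, g', h_LL; B) + E₀(amplRR T; g, g', h_RR; B) ≤ 2E₀(T; g, g', h; B)`.
[cite: Koma2022, (2.13), Prop. 5.1, §8] [cite: Lieb1994, Remark (iii)] [cite: LiebNachtergaele1995, Lemma 3.1] -/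
theorem groundEnergy_add_le_two_mul_coulomb {g : ℝ} (hg : 0 ≤ g) {g' : ℝ} (hg' : 0 ≤ g')
    {tc : Fin 2 → FermionTorus (d + 1) L → ℝ} (htc : ∀ σ x, IsBoundary L x → 0 ≤ tc σ x) (U : ℝ)
    (T : Fin 2 → FermionTorus (d + 1) L → FermionTorus (d + 1) L → ℂ)
    (hT : ∀ σ x y, T σ y x = star (T σ x y)) (hcut : ∀ σ x, IsBoundary L x → T σ x (reflect x) = tc σ x)
    (h : FermionTorus (d + 1) L → FermionTorus (d + 1) L → ℝ) (B : ℝ) :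
    (PairHopRP.hamiltonianC (G d L) (amplLL T) U g g' (fieldLL h) B).groundEnergy +
        (PairHopRP.hamiltonianC (G d L) (amplRR T) U g g' (fieldRR h) B).groundEnergy ≤
      2 * (PairHopRP.hamiltonianC (G d L) T U g g' h B).groundEnergy :=
  haveI : Nonempty (Finset (Orb (FermionTorus (d + 1) L))) := ⟨∅⟩
  Matrix.groundEnergy_add_le_two_mul_of_partitionFn_sq_le
    (hamiltonianC_isHermitian (G d L) T hT U g g' h B)
    (hamiltonianC_isHermitian (G d L) (amplLL T) (amplLL_herm hT) U g g' (fieldLL h) B)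
    (hamiltonianC_isHermitian (G d L) (amplRR T) (amplRR_herm hT) U g g' (fieldRR h) B)
    (fun _ hβ' => partitionFn_sq_le_reflected_coulomb hL h4 hβ'.le hg hg' htc U T hT hcut h B)

end Main

end PairHopCutRP

end Literature.MathematicalPhysics.QuantumLattice

end
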